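import Summits.BirchSwinnertonDyer.BirchSwinnertonDyer.Theorems.GenusKolyvaginAtTwoShaConsistencyLawFreeCells
import Summits.BirchSwinnertonDyer.BirchSwinnertonDyer.Theorems.GenusKolyvaginAtTwoEquivariantKolyvaginExactAtTwoRT
import Summits.BirchSwinnertonDyer.BirchSwinnertonDyer.Theorems.GenusKolyvaginAtTwoKolyvaginExactAtTwoPosDiscT
import Summits.BirchSwinnertonDyer.BirchSwinnertonDyer.Theorems.GenusKolyvaginAtTwoEquivariantChebotarevAtTwoR
import Summits.BirchSwinnertonDyer.BirchSwinnertonDyer.Theorems.GenusKolyvaginAtTwoCyclicTorsionOfNegDisc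
import Summits.BirchSwinnertonDyer.BirchSwinnertonDyer.Theorems.GenusKolyvaginAtTwoShaCardDvdPowAtTwoPosTB2QSignFree
import Summits.BirchSwinnertonDyer.BirchSwinnertonDyer.Theorems.GenusKolyvaginAtTwoKFourOfShaRatCard
import Summits.BirchSwinnertonDyer.BirchSwinnertonDyer.Theorems.GenusKolyvaginAtTwoShaCardDvdPowAtTwoPosTOnCut
import HarnessLib

/-!
# Route `GenusKolyvaginAtTwo`, cruxes K₄ `K4Neg` (stmt-BirchSwinnertonDyer-31526) / K₄⁺ `K4Pos` (stmt-BirchSwinnertonDyer-31469):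
# A K₄ / K₄⁺ WITNESS PINS THE COMMON STRUCTURE — `Ш(E_K/K)[2^∞] ≃ Ш(E/ℚ)[2^∞] ≃ ℤ/2^(M₀) × ℤ/2^(M₀)` — modulo Q2 ONLY (no GZK, no rank binder,
# no Cassels–Tate adjointness); and on the K₄⁺ cell «witness ↔ #Ш(E/ℚ)[2^∞] = 4^(M₀)» GZK-free

Seat `bsd-line-gk2-p4` g29 (cell `bsd-f1-sign2`), WIDTH-5 attach on route `GenusKolyvaginAtTwo` rev 59; sequel of `…ShaConsistencyLawFree{,Cells}`
(p773292, p773829) and `…KFourOfShaRatCard` (p773982).  THEOREMS ONLY (no definition, no named fact, no `sorry`); standard axioms.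
**BSD is NOT proved by this file; K4Neg / K4Pos are NOT proved; no item is closed.**  CONDITIONAL on the route item Q2 `KolyvaginRelationAtTwo`
(24880; a tree theorem modulo the print fact 23091), displayed as `hQ2` — nothing else.

PARTITION (LEAD gk2-p1 g24, bus 12:46Z).  The CARDINALITY currency of K₄ is the LEAD's `…KFourCellShaCardCurrency` (p773559: on the Δ<0 cut, mod Q2,
K4Neg ⟺ `#Ш(E/ℚ)[2^∞] = 4^(M₀)` ⟺ `#Ш(E_K)[2^∞] = 4^(M₀)`), and the K₄⁺ exponent currency is gk2-p5 g36's `…KFourPosBTwoSharpIff` (p773302: mod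
Q2 + GZK, K4Pos ⟺ exactness over `K` ⟺ B₂ over `ℚ` sharp ⟺ one prime).  THIS file adds only what those do not carry:
* §0 `mordellWeilRank_eq_zero_and_finite_shaPrimary_rat_of_cut` — **`rank E(ℚ) = 0` and `Ш(E/ℚ)[2^∞]` finite on the cut, BOTH SIGNS, mod Q2**
  (Kolyvagin's B₂ over `ℚ` in Selmer form, sign-free: `two_pow_smul_selmer_rat_eq_zero_of_regularPairSupply` + `regularPairSupply_of_heegner`, then
  Kummer `mordellWeilRank_eq_zero_of_two_pow_smul_selmer_eq_zero`; `Ш`-form ⟹ `finite_primaryComponent_sha_rat_two_of_exponent`) — the «Δ > 0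
  twin of `mordellWeilRank_rat_eq_zero_onHabitat`» that removes `hGZK` from the K₄⁺ currency (LEAD 12:46Z).
* §0b `exists_addEquiv_shaPrimary_of_kFourNeg_cut` / `exists_addEquiv_shaPrimary_of_kFourPos_cut` — NO WITNESS NEEDED, mod Q2, all count binders
  discharged (U_T′ / U⁺_T on the cut give finiteness of `Ш(E_K)[2^∞]` and `e ≤ M₀`): **on the K₄ / K₄⁺ cut cells `Ш(E_K/K)[2^∞] ≃ Ш(E/ℚ)[2^∞] ≃
  ℤ/2^e × ℤ/2^e` for ONE `e` with `1 ≤ e ≤ M₀`** — the census statement; K₄ / K₄⁺ at `E` ⟺ `e = M₀`.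
* §1 `natCard_shaPrimary_rat_eq_pow_of_kFourNeg_witness` — on Q3R_T′'s cut + the K₄ cell, a K4Neg WITNESS gives **`#Ш(E/ℚ)[2^∞] = 2^(2M₀)` AND
  `Ш(E_K/K)[2^∞] ≃ ℤ/2^(M₀) × ℤ/2^(M₀) ≃ Ш(E/ℚ)[2^∞]`** (exactness Q3R_T′ `equivariantKolyvaginExactAtTwoRT_proof` + §0 + the `hRC`-free
  cell law `natCard_shaPrimary_baseChange_eq_rat_of_kFourNeg_cell`; the cardinality clause is a SECOND, independent road to p773559 §1 — the
  STRUCTURE clauses are new: the one-block exponent `e` of p766296 is PINNED to `M₀` on both sides by a witness).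
* §2 `natCard_shaPrimary_rat_eq_pow_of_kFourPos_witness` — the same on Q4_T″'s cut + the K₄⁺ cell (`kolyvaginExactAtTwoPosDiscT_proof`), GZK-free.
* §3 `kFourPos_witness_iff_natCard_shaPrimary_rat_eq_pow` — on the K₄⁺ cut cell with `M₀ ≥ 1`, mod Q2 ONLY: **(∃ transposition-deep witness) ↔
  `#Ш(E/ℚ)[2^∞] = 4^(M₀)`** («←» = p773982).  The Δ<0 `↔` in this currency is the LEAD's `kFourNeg_conclusion_iff_natCard_sha_rat_eq_pow` — not
  repeated here.
READING: with a witness BOTH Tate–Shafarevich 2-primary parts are the single Kolyvagin–McCallum block `(ℤ/2^(M₀))²`; K₄ / K₄⁺ (the existence of the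
witness) remain open = the 2-part of BSD for the rank-0 curve given the Gross–Zagier–Kolyvagin index.  Nothing here decides it.

References: [McCallumLMS1991] §5 Thm. 5.4; [Kolyvagin1989Izv] Thm. B₂; [Kramer1981] Thm. 1; [Cassels1962ArithmeticIV] §1; [GrossLMS1991] §5 Prop. 5.3.
-/
set_option autoImplicit false
set_option linter.dupNamespace false -- `Summit.<P>.<Sub>` repeats `BirchSwinnertonDyer` (D-0017)

noncomputable section

open scoped Classical

namespace Summit.BirchSwinnertonDyer.BirchSwinnertonDyer.Theorems.GenusExact.ShaCores

open WeierstrassCurve NumberField IsDedekindDomain Field AddSubgroup Literature.NumberTheory.EllipticCurves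
  Literature.NumberTheory.GaloisRepresentations Literature.NumberTheory.EllipticCurves.ModularForms
  Literature.NumberTheory.EllipticCurves.RingClassField
open Summit.BirchSwinnertonDyer.BirchSwinnertonDyer.Theses.GenusKolyvaginAtTwo (KolyvaginRelationAtTwo)
open Summit.BirchSwinnertonDyer.BirchSwinnertonDyer.Theorems.GenusExact.PlusDescent

variable (W : WeierstrassCurve ℚ) [W.IsElliptic] [W.IsGloballyMinimal] [NeZero (W.conductorNorm ℤ)]
variable (K : Type) [Field K] [NumberField K]

/-! ## §0 The count binders from B₂ over `ℚ` on the cut (mod Q2) -/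

/-- **`rank E(ℚ) = 0` and `Ш(E/ℚ)[2^∞]` finite on the cut, mod Q2** — Kolyvagin's Theorem B₂ over `ℚ`, sign-free (gk2-p5 g31 / gk2-p3 g27): the
Selmer form (`two_pow_smul_selmer_rat_eq_zero_of_regularPairSupply` with `regularPairSupply_of_heegner`) gives the rank by Kummer
(`mordellWeilRank_eq_zero_of_two_pow_smul_selmer_eq_zero`), the `Ш`-form (`two_pow_M0_smul_eq_zero_of_mem_sha_rat_signFree`) the finiteness.
[cite: Kolyvagin1989Izv, Thm. B₂] [cite: SilvermanAEC2009, Thm. X.4.2] -/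
theorem mordellWeilRank_eq_zero_and_finite_shaPrimary_rat_of_cut (hQ2 : KolyvaginRelationAtTwo) (hcm : ¬ W.HasCM)
    (hT : Odd W.tamagawaProduct) (v : HeightOneSpectrum (𝓞 ℚ)) (h2v : ((2 : ℕ) : 𝓞 ℚ) ∉ v.asIdeal)
    (hNv : ((W.conductorNorm ℤ : ℕ) : 𝓞 ℚ) ∈ v.asIdeal) (hmult : W.HasMultiplicativeReductionAt v)
    (hIQ : IsImaginaryQuadratic K) (hodd : Odd (NumberField.discr K))
    (h3 : NumberField.discr K ≠ -3) (hHe : SatisfiesHeegnerHypothesis (W.conductorNorm ℤ) K)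
    (hsq1 : ¬ IsSquare ((NumberField.discr K : ℚ) * -|W.Δ|)) (hsq2 : ¬ IsSquare ((NumberField.discr K : ℚ) * (-(2 * |W.Δ|))))
    (hρ : ∀ n : ℕ, 0 < n → W.HasSurjectiveModNGaloisRep ((2 : ℤ) ^ n))
    (Dt : ModularParametrizationData W (W.conductorNorm ℤ)) (β : ℤ) (ι : K →+* ℂ) (d₁ : KolyvaginHeegnerData Dt β ι 1) (M₀ : ℕ)
    (hndiv : ¬ ∃ Q : (W.baseChange (ringClassField K ι 1)).toAffine.Point, ((2 ^ (M₀ + 1) : ℕ) : ℤ) • Q = d₁.derivedPoint)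
    (hw : W.rootNumber = 1) :
    W.mordellWeilRank = 0 ∧ Finite (AddCommGroup.primaryComponent (↥W.sha) 2) := by
  have hPair := regularPairSupply_of_heegner W K hIQ hodd hHe hρ
  refine ⟨mordellWeilRank_eq_zero_of_two_pow_smul_selmer_eq_zero W fun s hs ↦
      two_pow_smul_selmer_rat_eq_zero_of_regularPairSupply hQ2 W hcm hT v h2v hNv hmult K hIQ hodd h3 hHe hsq1 hsq2 hρ Dt β ι d₁ M₀ hndiv hw
        hPair (M₀ + 1) s hs, ?_⟩
  exact finite_primaryComponent_sha_rat_two_of_exponent W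
    (forall_primaryComponent_sha_two_pow_smul_eq_zero_of_galH1 W fun k a ha hka ↦
      two_pow_M0_smul_eq_zero_of_mem_sha_rat_signFree hQ2 W hcm hT v h2v hNv hmult K hIQ hodd h3 hHe hsq1 hsq2 hρ Dt β ι d₁ M₀ hndiv hw k a
        ha hka)

/-! ## §0b No witness needed: on the cut cells both Tate–Shafarevich 2-primary parts are ONE block `(ℤ/2^e)²` with `1 ≤ e ≤ M₀` (mod Q2) -/

/-- **THE K₄ CUT CELL, mod Q2, WITHOUT a witness: `Ш(E_K/K)[2^∞] ≃ Ш(E/ℚ)[2^∞] ≃ ℤ/2^e × ℤ/2^e` for ONE `e` with `1 ≤ e ≤ M₀`.**  Frame: the Δ<0 cut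
(odd multiplicative prime `v`, the two B₂ non-squares, `ρ_{E,2^n}` onto, datum with `P(1)` of infinite order and `2^(M₀) ∥ P(1)`, twin `#Sel₂(Wd) = 2`,
`ord₂ C(Wd) ≤ 1`) + the K₄ cell (`#Sel₂(E) = 4`, `r_an(E) = 0`, prime frame, `2` split, `σ₀ ≠ 1`).  ALL count binders discharged: `rank E(ℚ) = 0` and
`Ш(E/ℚ)[2^∞]` finite by §0, `Ш(E_K)[2^∞]` finite by U_T′ on the cut (`natCard_primaryComponent_sha_two_dvd_pow_onCut_of_shaExponent`: `∣ 4^(M₀)`,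
which also gives `e ≤ M₀`).  K4Neg at `E` ⟺ `e = M₀` (LEAD p773559); nothing here decides it.  CONDITIONAL on Q2; BSD NOT proved.
[cite: Kolyvagin1989Izv, Thm. B₂] [cite: McCallumLMS1991, §5 Cor. 5.6] [cite: Kramer1981, Thm. 1] [cite: Cassels1962ArithmeticIV, §1] -/
theorem exists_addEquiv_shaPrimary_of_kFourNeg_cut (hQ2 : KolyvaginRelationAtTwo) (hcm : ¬ W.HasCM)
    (hT : Odd W.tamagawaProduct) (v : HeightOneSpectrum (𝓞 ℚ)) (h2v : ((2 : ℕ) : 𝓞 ℚ) ∉ v.asIdeal)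
    (hNv : ((W.conductorNorm ℤ : ℕ) : 𝓞 ℚ) ∈ v.asIdeal) (hmult : W.HasMultiplicativeReductionAt v) (hΔ : W.Δ < 0)
    (hIQ : IsImaginaryQuadratic K) (hodd : Odd (NumberField.discr K))
    (h3 : NumberField.discr K ≠ -3) (hHe : SatisfiesHeegnerHypothesis (W.conductorNorm ℤ) K)
    (hsq1 : ¬ IsSquare ((NumberField.discr K : ℚ) * -|W.Δ|)) (hsq2 : ¬ IsSquare ((NumberField.discr K : ℚ) * (-(2 * |W.Δ|))))
    (hρ : ∀ n : ℕ, 0 < n → W.HasSurjectiveModNGaloisRep ((2 : ℤ) ^ n))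
    (Dt : ModularParametrizationData W (W.conductorNorm ℤ)) (β : ℤ) (ι : K →+* ℂ) (d₁ : KolyvaginHeegnerData Dt β ι 1)
    (hy : ¬ IsOfFinAddOrder d₁.derivedPoint) (M₀ : ℕ)
    (hdiv : ∃ Q : (W.baseChange (ringClassField K ι 1)).toAffine.Point, ((2 ^ M₀ : ℕ) : ℤ) • Q = d₁.derivedPoint)
    (hndiv : ¬ ∃ Q : (W.baseChange (ringClassField K ι 1)).toAffine.Point, ((2 ^ (M₀ + 1) : ℕ) : ℤ) • Q = d₁.derivedPoint)
    (Wd : WeierstrassCurve ℚ) [Wd.IsElliptic] (hWd : ∃ C : VariableChange ℚ, C • W.quadraticTwist (discr K : ℚ) = Wd)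
    (hSel : Nat.card (Wd.selmerGroup 2) = 2) (hDEF : padicValNat 2 Wd.tamagawaProduct ≤ 1)
    (h4 : Nat.card (W.selmerGroup 2) = 4) (hr0 : W.analyticRank = 0)
    (h2K : ((Ideal.span {(2 : ℤ)}).primesOver (𝓞 K)).ncard = 2) {ℓ₀ : ℕ} [Fact ℓ₀.Prime] (hd : discr K = -(ℓ₀ : ℤ))
    {σ₀ : K ≃ₐ[ℚ] K} (hσ₀ : σ₀ ≠ 1) :
    ∃ e : ℕ, 1 ≤ e ∧ e ≤ M₀ ∧
      Nonempty (AddCommGroup.primaryComponent (↥(W.baseChange K).sha) 2 ≃+ ZMod (2 ^ e) × ZMod (2 ^ e)) ∧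
      Nonempty (AddCommGroup.primaryComponent (↥W.sha) 2 ≃+ ZMod (2 ^ e) × ZMod (2 ^ e)) ∧
      Nat.card (AddCommGroup.primaryComponent (↥(W.baseChange K).sha) 2) = 4 ^ e ∧
      Nat.card (AddCommGroup.primaryComponent (↥W.sha) 2) = 4 ^ e := by
  haveI : Fact (Nat.Prime 2) := ⟨Nat.prime_two⟩
  have hw : W.rootNumber = 1 :=
    (Literature.Barriers.BirchSwinnertonDyer.even_analyticRank_iff_of_isNewformOf_conductorLevel Dt.isNewformOf).mp
      (by rw [hr0]; exact Even.zero)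
  have hs2 : W.HasSurjectiveModNGaloisRep 2 := by simpa using hρ 1 one_pos
  obtain ⟨hrk0, hfinY⟩ := mordellWeilRank_eq_zero_and_finite_shaPrimary_rat_of_cut W K hQ2 hcm hT v h2v hNv hmult hIQ hodd h3 hHe hsq1 hsq2
    hρ Dt β ι d₁ M₀ hndiv hw
  haveI := hfinY
  -- U_T′ on the cut: `#Ш(E_K)[2^∞] ∣ 4^(M₀)` (hence finite)
  have hUT := natCard_primaryComponent_sha_two_dvd_pow_onCut_of_shaExponent W K hT hΔ hIQ hodd hHe hs2 Dt β ι d₁ hy M₀ hndiv hw hrk0 Wd hWd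
    hSel hDEF (fun k a ha hka ↦ two_pow_M0_smul_eq_zero_of_mem_sha_rat_signFree hQ2 W hcm hT v h2v hNv hmult K hIQ hodd h3 hHe hsq1 hsq2 hρ Dt
      β ι d₁ M₀ hndiv hw k a ha hka)
  haveI : Finite (AddCommGroup.primaryComponent (↥(W.baseChange K).sha) 2) :=
    Nat.finite_of_card_ne_zero fun h0 ↦ by rw [h0, zero_dvd_iff] at hUT; exact pow_ne_zero _ two_ne_zero hUT
  have hsq : ¬ IsSquare ((NumberField.discr K : ℚ) * W.Δ) := by rwa [abs_of_neg hΔ, neg_neg] at hsq1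
  obtain ⟨-, -, e, he1, hX, hY, hXe, hYe⟩ := natCard_shaPrimary_baseChange_eq_rat_of_kFourNeg_cell W K hΔ hs2 h4 hIQ hodd hHe h2K hd Wd hWd
    hSel hσ₀ hr0 hsq Dt β ι d₁ hy hdiv hndiv hrk0
  refine ⟨e, he1, ?_, hX, hY, hXe, hYe⟩
  rw [hXe, pow_mul, show (2 : ℕ) ^ 2 = 4 by norm_num] at hUT
  exact (Nat.pow_dvd_pow_iff_le_right (by norm_num : 1 < 4)).mp hUT

/-- **THE K₄⁺ CUT CELL, mod Q2, WITHOUT a witness: `Ш(E_K/K)[2^∞] ≃ Ш(E/ℚ)[2^∞] ≃ ℤ/2^e × ℤ/2^e` for ONE `e` with `1 ≤ e ≤ M₀`** (Δ > 0, real-narrow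
`#Sel₂(E) = 4` cell, shallow twin `ord₂ C(Wd) = 0`; U⁺_T on the cut `natCard_primaryComponent_sha_two_dvd_pow_onOddTwinCut_of_shaExponent` for
finiteness of `Ш(E_K)[2^∞]` and `e ≤ M₀`; §0 for the `ℚ`-side count binders).  K4Pos at `E` ⟺ `e = M₀` (gk2-p5 p773302 / §3); nothing here decides it.
CONDITIONAL on Q2; BSD NOT proved. [cite: Kolyvagin1989Izv, Thm. B₂] [cite: McCallumLMS1991, §5 Cor. 5.6] [cite: Kramer1981, Thm. 1] [cite: Cassels1962ArithmeticIV, §1] -/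
theorem exists_addEquiv_shaPrimary_of_kFourPos_cut (hQ2 : KolyvaginRelationAtTwo) (hcm : ¬ W.HasCM)
    (hT : Odd W.tamagawaProduct) (v : HeightOneSpectrum (𝓞 ℚ)) (h2v : ((2 : ℕ) : 𝓞 ℚ) ∉ v.asIdeal)
    (hNv : ((W.conductorNorm ℤ : ℕ) : 𝓞 ℚ) ∈ v.asIdeal) (hmult : W.HasMultiplicativeReductionAt v) (hpos : 0 < W.Δ)
    (hIQ : IsImaginaryQuadratic K) (hodd : Odd (NumberField.discr K))
    (h3 : NumberField.discr K ≠ -3) (hHe : SatisfiesHeegnerHypothesis (W.conductorNorm ℤ) K)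
    (hsq1 : ¬ IsSquare ((NumberField.discr K : ℚ) * -|W.Δ|)) (hsq2 : ¬ IsSquare ((NumberField.discr K : ℚ) * (-(2 * |W.Δ|))))
    (hρ : ∀ n : ℕ, 0 < n → W.HasSurjectiveModNGaloisRep ((2 : ℤ) ^ n))
    (Dt : ModularParametrizationData W (W.conductorNorm ℤ)) (β : ℤ) (ι : K →+* ℂ) (d₁ : KolyvaginHeegnerData Dt β ι 1)
    (hy : ¬ IsOfFinAddOrder d₁.derivedPoint) (M₀ : ℕ)
    (hdiv : ∃ Q : (W.baseChange (ringClassField K ι 1)).toAffine.Point, ((2 ^ M₀ : ℕ) : ℤ) • Q = d₁.derivedPoint)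
    (hndiv : ¬ ∃ Q : (W.baseChange (ringClassField K ι 1)).toAffine.Point, ((2 ^ (M₀ + 1) : ℕ) : ℤ) • Q = d₁.derivedPoint)
    (Wd : WeierstrassCurve ℚ) [Wd.IsElliptic] (Cd : VariableChange ℚ) (hCd : Cd • W.quadraticTwist (discr K : ℚ) = Wd)
    (hSel : Nat.card (Wd.selmerGroup 2) = 2) (hDEF : padicValNat 2 Wd.tamagawaProduct = 0)
    (h4 : Nat.card (W.selmerGroup 2) = 4 ∧ ∃ c ∈ (W.kummerSelmerStructure ((2 : ℕ) : ℤ)).selmerGroup,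
      galoisCohomology.localization (W.torsionGaloisModule ((2 : ℕ) : ℤ)) (Sum.inl Rat.infinitePlace) 1 c ≠ 0)
    (hr0 : W.analyticRank = 0) (h2K : ((Ideal.span {(2 : ℤ)}).primesOver (𝓞 K)).ncard = 2) {σ₀ : K ≃ₐ[ℚ] K} (hσ₀ : σ₀ ≠ 1) :
    ∃ e : ℕ, 1 ≤ e ∧ e ≤ M₀ ∧
      Nonempty (AddCommGroup.primaryComponent (↥(W.baseChange K).sha) 2 ≃+ ZMod (2 ^ e) × ZMod (2 ^ e)) ∧
      Nonempty (AddCommGroup.primaryComponent (↥W.sha) 2 ≃+ ZMod (2 ^ e) × ZMod (2 ^ e)) ∧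
      Nat.card (AddCommGroup.primaryComponent (↥(W.baseChange K).sha) 2) = 4 ^ e ∧
      Nat.card (AddCommGroup.primaryComponent (↥W.sha) 2) = 4 ^ e := by
  haveI : Fact (Nat.Prime 2) := ⟨Nat.prime_two⟩
  have hw : W.rootNumber = 1 :=
    (Literature.Barriers.BirchSwinnertonDyer.even_analyticRank_iff_of_isNewformOf_conductorLevel Dt.isNewformOf).mp
      (by rw [hr0]; exact Even.zero)
  have hs2 : W.HasSurjectiveModNGaloisRep 2 := by simpa using hρ 1 one_pos
  have hWd : ∃ C : VariableChange ℚ, C • W.quadraticTwist (discr K : ℚ) = Wd := ⟨Cd, hCd⟩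
  obtain ⟨hrk0, hfinY⟩ := mordellWeilRank_eq_zero_and_finite_shaPrimary_rat_of_cut W K hQ2 hcm hT v h2v hNv hmult hIQ hodd h3 hHe hsq1 hsq2
    hρ Dt β ι d₁ M₀ hndiv hw
  haveI := hfinY
  have hUT := natCard_primaryComponent_sha_two_dvd_pow_onOddTwinCut_of_shaExponent W K hT hpos hIQ hodd hHe hs2 Dt β ι d₁ hy M₀ hndiv hw hrk0
    Wd hWd hSel hDEF (fun k a ha hka ↦ two_pow_M0_smul_eq_zero_of_mem_sha_rat_signFree hQ2 W hcm hT v h2v hNv hmult K hIQ hodd h3 hHe hsq1 hsq2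
      hρ Dt β ι d₁ M₀ hndiv hw k a ha hka)
  haveI : Finite (AddCommGroup.primaryComponent (↥(W.baseChange K).sha) 2) :=
    Nat.finite_of_card_ne_zero fun h0 ↦ by rw [h0, zero_dvd_iff] at hUT; exact pow_ne_zero _ two_ne_zero hUT
  have hsq : ¬ IsSquare ((NumberField.discr K : ℚ) * W.Δ) := by
    rintro ⟨r, hr⟩
    have hneg : (NumberField.discr K : ℚ) * W.Δ < 0 :=
      mul_neg_of_neg_of_pos (by exact_mod_cast IsImaginaryQuadratic.discr_neg hIQ) hpos
    rw [hr] at hneg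
    exact absurd hneg (not_lt.mpr (mul_self_nonneg r))
  obtain ⟨-, -, e, he1, hX, hY, hXe, hYe⟩ := natCard_shaPrimary_baseChange_eq_rat_of_kFourPos_cell W K hpos hs2 hT h4 hIQ hodd hHe h2K hσ₀ Cd
    hCd hDEF hSel hr0 hsq Dt β ι d₁ hy hdiv hndiv hrk0
  refine ⟨e, he1, ?_, hX, hY, hXe, hYe⟩
  rw [hXe, pow_mul, show (2 : ℕ) ^ 2 = 4 by norm_num] at hUT
  exact (Nat.pow_dvd_pow_iff_le_right (by norm_num : 1 < 4)).mp hUT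

/-! ## §1 K₄ (Δ < 0): a deep witness forces `#Ш(E/ℚ)[2^∞] = 4^(M₀)` -/

/-- ★ **A K4Neg WITNESS FORCES `#Ш(E/ℚ)[2^∞] = 2^(2M₀)` AND `Ш(E_K/K)[2^∞] ≃ Ш(E/ℚ)[2^∞] ≃ ℤ/2^(M₀) × ℤ/2^(M₀)`, mod Q2.**  Frame: Q3R_T′'s
cut (globally minimal non-CM `E/ℚ`, odd Tamagawa product, an odd multiplicative prime, `Δ < 0`, `K` imaginary quadratic with `d_K` odd `≠ −3`,
Heegner, the two Theorem-B₂ non-squares, `ρ_{E,2^n}` onto; a datum with `P(1)` of infinite order and `2^(M₀) ∥ P(1)`; a globally minimal twin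
`Wd ≅ E^(d_K)` with `#Sel₂(Wd) = 2`, `ord₂ C(Wd) ≤ 1`) + the K₄ cell (`#Sel₂(E) = 4`, `r_an(E) = 0`, prime frame `d_K = −ℓ₀`, `2` split, `σ₀ ≠ 1`) +
a WITNESS (`n` square-free, every `ℓ ∣ n` Zhang–Kolyvagin at `2` of index `≥ 2` with `FrobEqFrobInfty`, `P(n) ∉ 2E(K[n])`).  Proof: Q3R_T′
(`equivariantKolyvaginExactAtTwoRT_proof`, fed with Q2, Q5R `equivariantChebotarevAtTwoR_proof`, Q1 `cyclicTorsionOfNegDisc_proof`) gives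
`#Ш(E_K)[2^∞] = 2^(2M₀)`; §0 gives the count binders; `natCard_shaPrimary_baseChange_eq_rat_of_kFourNeg_cell` transfers to `ℚ` and gives the
structure with `e = M₀`.  CONDITIONAL on Q2; BSD / K4Neg NOT proved by this. [cite: McCallumLMS1991, §5 Thm. 5.4] [cite: Kramer1981, Thm. 1]
[cite: Cassels1962ArithmeticIV, §1] -/
theorem natCard_shaPrimary_rat_eq_pow_of_kFourNeg_witness (hQ2 : KolyvaginRelationAtTwo) (hcm : ¬ W.HasCM)
    (hT : Odd W.tamagawaProduct) (v : HeightOneSpectrum (𝓞 ℚ)) (h2v : ((2 : ℕ) : 𝓞 ℚ) ∉ v.asIdeal)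
    (hNv : ((W.conductorNorm ℤ : ℕ) : 𝓞 ℚ) ∈ v.asIdeal) (hmult : W.HasMultiplicativeReductionAt v) (hΔ : W.Δ < 0)
    (hIQ : IsImaginaryQuadratic K) (hodd : Odd (NumberField.discr K))
    (h3 : NumberField.discr K ≠ -3) (hHe : SatisfiesHeegnerHypothesis (W.conductorNorm ℤ) K)
    (hsq1 : ¬ IsSquare ((NumberField.discr K : ℚ) * -|W.Δ|)) (hsq2 : ¬ IsSquare ((NumberField.discr K : ℚ) * (-(2 * |W.Δ|))))
    (hρ : ∀ n : ℕ, 0 < n → W.HasSurjectiveModNGaloisRep ((2 : ℤ) ^ n))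
    (Dt : ModularParametrizationData W (W.conductorNorm ℤ)) (β : ℤ) (ι : K →+* ℂ) (d₁ : KolyvaginHeegnerData Dt β ι 1)
    (hy : ¬ IsOfFinAddOrder d₁.derivedPoint) (M₀ : ℕ)
    (hdiv : ∃ Q : (W.baseChange (ringClassField K ι 1)).toAffine.Point, ((2 ^ M₀ : ℕ) : ℤ) • Q = d₁.derivedPoint)
    (hndiv : ¬ ∃ Q : (W.baseChange (ringClassField K ι 1)).toAffine.Point, ((2 ^ (M₀ + 1) : ℕ) : ℤ) • Q = d₁.derivedPoint)
    (Wd : WeierstrassCurve ℚ) [Wd.IsElliptic] [Wd.IsGloballyMinimal] (hWd : ∃ C : VariableChange ℚ, C • W.quadraticTwist (discr K : ℚ) = Wd)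
    (hSel : Nat.card (Wd.selmerGroup 2) = 2) (hDEF : padicValNat 2 Wd.tamagawaProduct ≤ 1)
    -- the K₄ cell
    (h4 : Nat.card (W.selmerGroup 2) = 4) (hr0 : W.analyticRank = 0)
    (h2K : ((Ideal.span {(2 : ℤ)}).primesOver (𝓞 K)).ncard = 2) {ℓ₀ : ℕ} [Fact ℓ₀.Prime] (hd : discr K = -(ℓ₀ : ℤ))
    {σ₀ : K ≃ₐ[ℚ] K} (hσ₀ : σ₀ ≠ 1)
    -- the witness
    (n : ℕ) (d : KolyvaginHeegnerData Dt β ι n) (hn : Squarefree n)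
    (hKoly : ∀ ℓ ∈ n.primeFactors, Zhang2014.IsKolyvaginPrime (W.conductorNorm ℤ) W K 2 ℓ ∧ 2 ≤ Zhang2014.kolyvaginIndex W 2 ℓ ∧
      FrobEqFrobInfty W K 2 ℓ)
    (hPn : ¬ ∃ Q : (W.baseChange (ringClassField K ι n)).toAffine.Point, (2 : ℤ) • Q = d.derivedPoint) :
    Nat.card (AddCommGroup.primaryComponent (↥W.sha) 2) = 2 ^ (2 * M₀) ∧
      Nonempty (AddCommGroup.primaryComponent (↥(W.baseChange K).sha) 2 ≃+ ZMod (2 ^ M₀) × ZMod (2 ^ M₀)) ∧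
      Nonempty (AddCommGroup.primaryComponent (↥W.sha) 2 ≃+ ZMod (2 ^ M₀) × ZMod (2 ^ M₀)) := by
  haveI : Fact (Nat.Prime 2) := ⟨Nat.prime_two⟩
  have hw : W.rootNumber = 1 :=
    (Literature.Barriers.BirchSwinnertonDyer.even_analyticRank_iff_of_isNewformOf_conductorLevel Dt.isNewformOf).mp
      (by rw [hr0]; exact Even.zero)
  -- Kolyvagin exactness over `K` (Q3R_T′, proved): `#Ш(E_K)[2^∞] = 2^(2M₀)`
  have hX : Nat.card (AddCommGroup.primaryComponent (W.baseChange K).sha 2) = 2 ^ (2 * M₀) :=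
    equivariantKolyvaginExactAtTwoRT_proof hQ2 GenusExact.equivariantChebotarevAtTwoR_proof GenusCyclicTorsion.cyclicTorsionOfNegDisc_proof W
      hcm hT v h2v hNv hmult hΔ K hIQ hodd h3 hHe hsq1 hsq2 hρ Dt β ι d₁ hy M₀ hdiv hndiv hw Wd hWd hSel hDEF n d hn hKoly hPn
  haveI : Finite (AddCommGroup.primaryComponent (↥(W.baseChange K).sha) 2) :=
    Nat.finite_of_card_ne_zero (by rw [hX]; positivity)
  -- the `ℚ`-side count binders from B₂ over `ℚ`
  obtain ⟨hrk0, hfinY⟩ := mordellWeilRank_eq_zero_and_finite_shaPrimary_rat_of_cut W K hQ2 hcm hT v h2v hNv hmult hIQ hodd h3 hHe hsq1 hsq2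
    hρ Dt β ι d₁ M₀ hndiv hw
  haveI := hfinY
  have hs2 : W.HasSurjectiveModNGaloisRep 2 := by simpa using hρ 1 one_pos
  have hsq : ¬ IsSquare ((NumberField.discr K : ℚ) * W.Δ) := by rwa [abs_of_neg hΔ, neg_neg] at hsq1
  obtain ⟨heq, -, e, -, ⟨eX⟩, ⟨eY⟩, hXe, -⟩ := natCard_shaPrimary_baseChange_eq_rat_of_kFourNeg_cell W K hΔ hs2 h4 hIQ hodd hHe h2K hd Wd hWd
    hSel hσ₀ hr0 hsq Dt β ι d₁ hy hdiv hndiv hrk0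
  -- `e = M₀`
  have heM : 4 ^ e = 4 ^ M₀ := by rw [← hXe, hX, pow_mul]; norm_num
  obtain rfl : e = M₀ := Nat.pow_right_injective (by norm_num : 2 ≤ 4) heM
  exact ⟨by rw [← heq, hX], ⟨eX⟩, ⟨eY⟩⟩

/-! ## §2 K₄⁺ (Δ > 0): a transposition-deep witness forces `#Ш(E/ℚ)[2^∞] = 4^(M₀)` -/

/-- ★ **A K4Pos WITNESS FORCES `#Ш(E/ℚ)[2^∞] = 2^(2M₀)` AND `Ш(E_K/K)[2^∞] ≃ Ш(E/ℚ)[2^∞] ≃ ℤ/2^(M₀) × ℤ/2^(M₀)`, mod Q2.**  Frame: Q4_T″'s cut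
(as in §1 with `Δ > 0` and the shallow twin `ord₂ C(Wd) = 0`) + the K₄⁺ cell (the real-narrow `#Sel₂(E) = 4` clause, `r_an(E) = 0`, `2` split in
`K`, `σ₀ ≠ 1`) + a WITNESS (`n` square-free of Zhang–Kolyvagin primes at `2` of index `≥ 2` with an arithmetic Frobenius moving a point of `E[2]`,
`P(n) ∉ 2E(K[n])`).  Proof: Q4_T″ (`kolyvaginExactAtTwoPosDiscT_proof`, fed with Q2) + §0 + `natCard_shaPrimary_baseChange_eq_rat_of_kFourPos_cell`.
CONDITIONAL on Q2; BSD / K4Pos NOT proved by this. [cite: McCallumLMS1991, §5 Thm. 5.4] [cite: Kramer1981, Thm. 1] [cite: Cassels1962ArithmeticIV, §1] -/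
theorem natCard_shaPrimary_rat_eq_pow_of_kFourPos_witness (hQ2 : KolyvaginRelationAtTwo) (hcm : ¬ W.HasCM)
    (hT : Odd W.tamagawaProduct) (v : HeightOneSpectrum (𝓞 ℚ)) (h2v : ((2 : ℕ) : 𝓞 ℚ) ∉ v.asIdeal)
    (hNv : ((W.conductorNorm ℤ : ℕ) : 𝓞 ℚ) ∈ v.asIdeal) (hmult : W.HasMultiplicativeReductionAt v) (hpos : 0 < W.Δ)
    (hIQ : IsImaginaryQuadratic K) (hodd : Odd (NumberField.discr K))
    (h3 : NumberField.discr K ≠ -3) (hHe : SatisfiesHeegnerHypothesis (W.conductorNorm ℤ) K)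
    (hsq1 : ¬ IsSquare ((NumberField.discr K : ℚ) * -|W.Δ|)) (hsq2 : ¬ IsSquare ((NumberField.discr K : ℚ) * (-(2 * |W.Δ|))))
    (hρ : ∀ n : ℕ, 0 < n → W.HasSurjectiveModNGaloisRep ((2 : ℤ) ^ n))
    (Dt : ModularParametrizationData W (W.conductorNorm ℤ)) (β : ℤ) (ι : K →+* ℂ) (d₁ : KolyvaginHeegnerData Dt β ι 1)
    (hy : ¬ IsOfFinAddOrder d₁.derivedPoint) (M₀ : ℕ)
    (hdiv : ∃ Q : (W.baseChange (ringClassField K ι 1)).toAffine.Point, ((2 ^ M₀ : ℕ) : ℤ) • Q = d₁.derivedPoint)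
    (hndiv : ¬ ∃ Q : (W.baseChange (ringClassField K ι 1)).toAffine.Point, ((2 ^ (M₀ + 1) : ℕ) : ℤ) • Q = d₁.derivedPoint)
    (Wd : WeierstrassCurve ℚ) [Wd.IsElliptic] [Wd.IsGloballyMinimal] (Cd : VariableChange ℚ) (hCd : Cd • W.quadraticTwist (discr K : ℚ) = Wd)
    (hSel : Nat.card (Wd.selmerGroup 2) = 2) (hDEF : padicValNat 2 Wd.tamagawaProduct = 0)
    -- the K₄⁺ cell
    (h4 : Nat.card (W.selmerGroup 2) = 4 ∧ ∃ c ∈ (W.kummerSelmerStructure ((2 : ℕ) : ℤ)).selmerGroup,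
      galoisCohomology.localization (W.torsionGaloisModule ((2 : ℕ) : ℤ)) (Sum.inl Rat.infinitePlace) 1 c ≠ 0)
    (hr0 : W.analyticRank = 0) (h2K : ((Ideal.span {(2 : ℤ)}).primesOver (𝓞 K)).ncard = 2) {σ₀ : K ≃ₐ[ℚ] K} (hσ₀ : σ₀ ≠ 1)
    -- the witness
    (n : ℕ) (d : KolyvaginHeegnerData Dt β ι n) (hn : Squarefree n)
    (hKoly : ∀ ℓ ∈ n.primeFactors, Zhang2014.IsKolyvaginPrime (W.conductorNorm ℤ) W K 2 ℓ ∧ 2 ≤ Zhang2014.kolyvaginIndex W 2 ℓ ∧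
      ∃ (v : HeightOneSpectrum (𝓞 ℚ)) (𝔓 : Ideal (absIntegers (𝓞 ℚ) ℚ)) (h : absoluteGaloisGroup ℚ),
        ((ℓ : ℕ) : 𝓞 ℚ) ∈ v.asIdeal ∧ 𝔓 ∈ v.primesAbove ∧ IsArithFrobAt (𝓞 ℚ) h 𝔓 ∧ ∃ u : W.geomTorsion ((2 : ℕ) : ℤ), h • u ≠ u)
    (hPn : ¬ ∃ Q : (W.baseChange (ringClassField K ι n)).toAffine.Point, (2 : ℤ) • Q = d.derivedPoint) :
    Nat.card (AddCommGroup.primaryComponent (↥W.sha) 2) = 2 ^ (2 * M₀) ∧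
      Nonempty (AddCommGroup.primaryComponent (↥(W.baseChange K).sha) 2 ≃+ ZMod (2 ^ M₀) × ZMod (2 ^ M₀)) ∧
      Nonempty (AddCommGroup.primaryComponent (↥W.sha) 2 ≃+ ZMod (2 ^ M₀) × ZMod (2 ^ M₀)) := by
  haveI : Fact (Nat.Prime 2) := ⟨Nat.prime_two⟩
  have hw : W.rootNumber = 1 :=
    (Literature.Barriers.BirchSwinnertonDyer.even_analyticRank_iff_of_isNewformOf_conductorLevel Dt.isNewformOf).mp
      (by rw [hr0]; exact Even.zero)
  have hWd : ∃ C : VariableChange ℚ, C • W.quadraticTwist (discr K : ℚ) = Wd := ⟨Cd, hCd⟩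
  -- Kolyvagin exactness over `K` (Q4_T″, proved): `#Ш(E_K)[2^∞] = 2^(2M₀)`
  have hX : Nat.card (AddCommGroup.primaryComponent (W.baseChange K).sha 2) = 2 ^ (2 * M₀) :=
    kolyvaginExactAtTwoPosDiscT_proof hQ2 W hcm hT v h2v hNv hmult hpos K hIQ hodd h3 hHe hsq1 hsq2 hρ Dt β ι d₁ hy M₀ hdiv hndiv hw Wd hWd
      hSel hDEF n d hn hKoly hPn
  haveI : Finite (AddCommGroup.primaryComponent (↥(W.baseChange K).sha) 2) :=
    Nat.finite_of_card_ne_zero (by rw [hX]; positivity)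
  -- the `ℚ`-side count binders from B₂ over `ℚ`
  obtain ⟨hrk0, hfinY⟩ := mordellWeilRank_eq_zero_and_finite_shaPrimary_rat_of_cut W K hQ2 hcm hT v h2v hNv hmult hIQ hodd h3 hHe hsq1 hsq2
    hρ Dt β ι d₁ M₀ hndiv hw
  haveI := hfinY
  have hs2 : W.HasSurjectiveModNGaloisRep 2 := by simpa using hρ 1 one_pos
  have hsq : ¬ IsSquare ((NumberField.discr K : ℚ) * W.Δ) := by
    rintro ⟨r, hr⟩
    have hneg : (NumberField.discr K : ℚ) * W.Δ < 0 :=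
      mul_neg_of_neg_of_pos (by exact_mod_cast IsImaginaryQuadratic.discr_neg hIQ) hpos
    rw [hr] at hneg
    exact absurd hneg (not_lt.mpr (mul_self_nonneg r))
  obtain ⟨heq, -, e, -, ⟨eX⟩, ⟨eY⟩, hXe, -⟩ := natCard_shaPrimary_baseChange_eq_rat_of_kFourPos_cell W K hpos hs2 hT h4 hIQ hodd hHe h2K hσ₀
    Cd hCd hDEF hSel hr0 hsq Dt β ι d₁ hy hdiv hndiv hrk0
  have heM : 4 ^ e = 4 ^ M₀ := by rw [← hXe, hX, pow_mul]; norm_num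
  obtain rfl : e = M₀ := Nat.pow_right_injective (by norm_num : 2 ≤ 4) heM
  exact ⟨by rw [← heq, hX], ⟨eX⟩, ⟨eY⟩⟩

/-! ## §3 The equivalence on the K₄⁺ cell: witness ↔ `#Ш(E/ℚ)[2^∞] = 4^(M₀)` (mod Q2, GZK-free) -/

/-- ★★ **K₄⁺ ⟺ THE 2-PART OF THE BSD CARDINALITY OVER `ℚ`, on the cell, mod Q2.**  On Q4_T″'s cut with the K₄⁺ cell data and `M₀ ≥ 1`:
**a transposition-deep K4Pos witness EXISTS iff `#Ш(E/ℚ)[2^∞] = 4^(M₀)`** (`Nat.card`, so the right side includes finiteness).  «→» is §2;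
«←» is p773982 `kFourPos_shape_of_natCard_shaPrimary_rat_eq_pow` (B2Q♭ of gk2-p5 + counting).  Companion of gk2-p5's exponent-currency `↔`
`kFourPos_shape_iff_exists_mem_sha_two_pow_pred_smul_ne_zero` (p773302, mod Q2 + GZK) in CARDINALITY currency and WITHOUT GZK (§0).  CONDITIONAL on
Q2 only; BSD / K4Pos are NOT proved by this — the theorem says precisely that K4Pos on this cell IS the statement `#Ш(E/ℚ)[2^∞] = 4^(M₀)`.
[cite: McCallumLMS1991, §5 Thm. 5.4] [cite: Kolyvagin1989Izv, Thm. B₂] [cite: Kramer1981, Thm. 1] -/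
theorem kFourPos_witness_iff_natCard_shaPrimary_rat_eq_pow (hQ2 : KolyvaginRelationAtTwo) (hcm : ¬ W.HasCM)
    (hT : Odd W.tamagawaProduct) (v : HeightOneSpectrum (𝓞 ℚ)) (h2v : ((2 : ℕ) : 𝓞 ℚ) ∉ v.asIdeal)
    (hNv : ((W.conductorNorm ℤ : ℕ) : 𝓞 ℚ) ∈ v.asIdeal) (hmult : W.HasMultiplicativeReductionAt v) (hpos : 0 < W.Δ)
    (hIQ : IsImaginaryQuadratic K) (hodd : Odd (NumberField.discr K))
    (h3 : NumberField.discr K ≠ -3) (hHe : SatisfiesHeegnerHypothesis (W.conductorNorm ℤ) K)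
    (hsq1 : ¬ IsSquare ((NumberField.discr K : ℚ) * -|W.Δ|)) (hsq2 : ¬ IsSquare ((NumberField.discr K : ℚ) * (-(2 * |W.Δ|))))
    (hρ : ∀ n : ℕ, 0 < n → W.HasSurjectiveModNGaloisRep ((2 : ℤ) ^ n))
    (Dt : ModularParametrizationData W (W.conductorNorm ℤ)) (β : ℤ) (ι : K →+* ℂ) (d₁ : KolyvaginHeegnerData Dt β ι 1)
    (hy : ¬ IsOfFinAddOrder d₁.derivedPoint) (M₀ : ℕ) (hM₀ : 1 ≤ M₀)
    (hdiv : ∃ Q : (W.baseChange (ringClassField K ι 1)).toAffine.Point, ((2 ^ M₀ : ℕ) : ℤ) • Q = d₁.derivedPoint)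
    (hndiv : ¬ ∃ Q : (W.baseChange (ringClassField K ι 1)).toAffine.Point, ((2 ^ (M₀ + 1) : ℕ) : ℤ) • Q = d₁.derivedPoint)
    (Wd : WeierstrassCurve ℚ) [Wd.IsElliptic] [Wd.IsGloballyMinimal] (Cd : VariableChange ℚ) (hCd : Cd • W.quadraticTwist (discr K : ℚ) = Wd)
    (hSel : Nat.card (Wd.selmerGroup 2) = 2) (hDEF : padicValNat 2 Wd.tamagawaProduct = 0)
    (h4 : Nat.card (W.selmerGroup 2) = 4 ∧ ∃ c ∈ (W.kummerSelmerStructure ((2 : ℕ) : ℤ)).selmerGroup,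
      galoisCohomology.localization (W.torsionGaloisModule ((2 : ℕ) : ℤ)) (Sum.inl Rat.infinitePlace) 1 c ≠ 0)
    (hr0 : W.analyticRank = 0) (h2K : ((Ideal.span {(2 : ℤ)}).primesOver (𝓞 K)).ncard = 2) {σ₀ : K ≃ₐ[ℚ] K} (hσ₀ : σ₀ ≠ 1) :
    (∃ (n : ℕ) (d : KolyvaginHeegnerData Dt β ι n), Squarefree n ∧
      (∀ ℓ ∈ n.primeFactors, Zhang2014.IsKolyvaginPrime (W.conductorNorm ℤ) W K 2 ℓ ∧ 2 ≤ Zhang2014.kolyvaginIndex W 2 ℓ ∧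
        ∃ (v : HeightOneSpectrum (𝓞 ℚ)) (𝔓 : Ideal (absIntegers (𝓞 ℚ) ℚ)) (h : absoluteGaloisGroup ℚ),
          ((ℓ : ℕ) : 𝓞 ℚ) ∈ v.asIdeal ∧ 𝔓 ∈ v.primesAbove ∧ IsArithFrobAt (𝓞 ℚ) h 𝔓 ∧ ∃ u : W.geomTorsion ((2 : ℕ) : ℤ), h • u ≠ u) ∧
      ¬ ∃ Q : (W.baseChange (ringClassField K ι n)).toAffine.Point, (2 : ℤ) • Q = d.derivedPoint) ↔
    Nat.card (AddCommGroup.primaryComponent (↥W.sha) 2) = 4 ^ M₀ := by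
  have hw : W.rootNumber = 1 :=
    (Literature.Barriers.BirchSwinnertonDyer.even_analyticRank_iff_of_isNewformOf_conductorLevel Dt.isNewformOf).mp
      (by rw [hr0]; exact Even.zero)
  constructor
  · rintro ⟨n, d, hn, hKoly, hPn⟩
    have h := (natCard_shaPrimary_rat_eq_pow_of_kFourPos_witness W K hQ2 hcm hT v h2v hNv hmult hpos hIQ hodd h3 hHe hsq1 hsq2 hρ Dt β ι d₁ hy
      M₀ hdiv hndiv Wd Cd hCd hSel hDEF h4 hr0 h2K hσ₀ n d hn hKoly hPn).1
    rw [h, pow_mul]; norm_num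
  · intro hY
    haveI : Finite (AddCommGroup.primaryComponent (↥W.sha) 2) := Nat.finite_of_card_ne_zero (by rw [hY]; positivity)
    have hSel4 : Nat.card (W.selmerGroup 2) ∣ 4 := by rw [h4.1]
    exact kFourPos_shape_of_natCard_shaPrimary_rat_eq_pow W hQ2 hcm hT v h2v hNv hmult K hIQ hodd h3 hHe hsq1 hsq2 hρ Dt β ι d₁ M₀ hndiv hw
      hM₀ hSel4 hY

end Summit.BirchSwinnertonDyer.BirchSwinnertonDyer.Theorems.GenusExact.ShaCores

end
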